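import Literature.MathematicalPhysics.StatisticalMechanics.Theil2006
import HarnessLib

/-!
# Theil 2006, §1: the normalization (1) by rescaling — "we can simply replace `V(r)` by the
rescaled potential `(−1/V_*(r_*)) V(r/r_*)`" (p. 3)

Topic `Literature/MathematicalPhysics/StatisticalMechanics`; companion of `Theil2006.lean`
(F. Theil, *A proof of crystallization in two dimensions*, Comm. Math. Phys. **262** (2006)
209–236, accepted preprint of 26 Aug 2005, p. 3, the paragraph after Corollary 1.3).

AS PRINTED: "The normalization (1) does not affect the scope of the results as for general
interaction potentials it can be shown without trouble that if the function
`V_*(r) = ⅙ ∑_{ξ ∈ A₂} V(r|ξ|)` does not admit a minimizer then the ground state can not be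
approximated by rotated, dilated and translated copies of subsets of `A₂`. On the other hand if
`r_* ∈ (0, ∞)` minimizes `V_*` and `V_*(r_*) ≠ 0` then we can simply replace `V(r)` by the rescaled
potential `(−1/V_*(r_*)) V(r/r_*)`."

What is here (the second sentence, made precise; everything proved, no named fact):

* `Theil2006.rescalePotential V r⋆` — the potential `r ↦ (−1/V_*(r⋆)) · V(r⋆ r)`
  (`V_* = latticeSum/6`, so the factor is `−6/latticeSum V r⋆`).
* `Theil2006.latticeSum_rescalePotential` — its dilated lattice sums:
  `∑_{ξ≠0} Ṽ(s|ξ|) = (−1/V_*(r⋆)) ∑_{ξ≠0} V(r⋆ s |ξ|)`.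
* `Theil2006.isNormalized_rescalePotential` — **if `r⋆ > 0` minimizes the dilated lattice sums
  of `V` over `r > 0`, with a negative minimum, then the rescaled potential is normalized in
  the sense of (1)** (`Theil2006.IsNormalized`: lattice sums summable for `r > 0`, `= −6` at
  `r = 1`, `≥ −6` for all `r > 0`, and `Ṽ → 0`), given that `V → 0` and the lattice sums of
  `V` converge.
* `Theil2006.interactionEnergy_rescalePotential`, `Theil2006.minEnergy_rescalePotential`,
  `Theil2006.tendsto_minEnergy_div_of_rescalePotential`,
  `Theil2006_groundStateEnergy.of_rescalePotential` — the operative content of "simply replace":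
  `E_Ṽ(y) = (−1/V_*(r⋆)) E_V(r⋆ y)`, `min E_Ṽ = (−1/V_*(r⋆)) min E_V`, and hence Theorem 1.1 for
  `Ṽ` gives `lim_N N⁻¹ min E_V = 3 V_*(r⋆)` for the unnormalized `V`.
* `Theil2006.latticeSum_neg_of_isMinOn` — the printed side condition "`V_*(r_*) ≠ 0`" already
  forces `V_*(r_*) < 0` when the lattice sums tend to `0` along some sequence of dilations
  (e.g. by the decay (5)); we take `< 0` as the hypothesis and record this remark.

PRINT NOTE (minor, recorded by the reading seat): with `r_*` the optimal DILATION of the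
lattice (`V_*(r) = ⅙∑ V(r|ξ|)` minimal at `r = r_*`, i.e. the optimal nearest-neighbour distance
is `r_*`), the potential whose optimal nearest-neighbour distance is `1` is `r ↦ V(r_* r)`; the
printed `V(r/r_*)` has optimal distance `r_*²` (the two agree only for `r_* = 1`). We formalize
the intended rescaling `V(r_* r)`. [cite: Theil2006, §1, remark after Corollary 1.3 (preprint p. 3)]
-/

noncomputable section

open scoped BigOperators Topology
open Filter Set

namespace Literature.MathematicalPhysics.StatisticalMechanics

namespace Theil2006

variable {V : ℝ → ℝ} {rs : ℝ}

/-- **The rescaled potential** `Ṽ(r) = (−1/V_*(r⋆)) V(r⋆ r) = (−6 / ∑_{ξ≠0} V(r⋆|ξ|)) V(r⋆ r)`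
of the remark on p. 3 (with the intended argument `r⋆ r`, see the module docstring).
[cite: Theil2006, §1, remark after Corollary 1.3 (preprint p. 3)] -/
def rescalePotential (V : ℝ → ℝ) (rs : ℝ) (r : ℝ) : ℝ :=
  -6 / latticeSum V rs * V (rs * r)

/-- The dilated lattice sums of the rescaled potential:
`∑_{ξ≠0} Ṽ(s|ξ|) = (−6/∑_{ξ≠0} V(r⋆|ξ|)) · ∑_{ξ≠0} V((r⋆ s)|ξ|)`.
[cite: Theil2006, §1 (1) and the remark after Corollary 1.3 (preprint pp. 2–3)] -/
theorem latticeSum_rescalePotential (V : ℝ → ℝ) (rs s : ℝ) :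
    latticeSum (rescalePotential V rs) s = -6 / latticeSum V rs * latticeSum V (rs * s) := by
  simp only [latticeSum, rescalePotential]
  rw [← tsum_mul_left]
  exact tsum_congr fun k => by rw [mul_assoc]

/-- The rows of the rescaled potential are those of `V` at the dilation `r⋆ r`, times a constant.
[cite: Theil2006, §1 (1) (preprint p. 2); our lemma] -/
theorem summable_rescalePotential (hsum : ∀ r : ℝ, 0 < r →
      Summable fun k : {k : ℤ × ℤ // k ≠ 0} => V (r * ‖triPoint k.1‖))
    (hrs : 0 < rs) {r : ℝ} (hr : 0 < r) :
    Summable fun k : {k : ℤ × ℤ // k ≠ 0} => rescalePotential V rs (r * ‖triPoint k.1‖) := by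
  unfold rescalePotential
  refine ((hsum (rs * r) (mul_pos hrs hr)).mul_left (-6 / latticeSum V rs)).congr fun k => ?_
  rw [mul_assoc]

/-- **"`V_*(r_*) ≠ 0`" means "`V_*(r_*) < 0`"**: if `r⋆` minimizes the dilated lattice sums over
`r > 0` and these come arbitrarily close to `0` from above or below along positive dilations
(they do under the decay (5), tending to `0` as `r → ∞`), then a non-zero minimum is negative.
[cite: Theil2006, §1, remark after Corollary 1.3 (preprint p. 3); our lemma] -/
theorem latticeSum_neg_of_isMinOn (hmin : ∀ r : ℝ, 0 < r → latticeSum V rs ≤ latticeSum V r)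
    (hne : latticeSum V rs ≠ 0)
    (hsmall : ∀ ε : ℝ, 0 < ε → ∃ r : ℝ, 0 < r ∧ latticeSum V r < ε) :
    latticeSum V rs < 0 := by
  rcases lt_or_gt_of_ne hne with h | h
  · exact h
  · obtain ⟨r, hr, hlt⟩ := hsmall (latticeSum V rs) h
    exact absurd (hmin r hr) (not_le.2 hlt)

/-- **The rescaling achieves the normalization (1).** Let `V → 0` at `∞` with convergent dilated
lattice sums `∑_{ξ≠0} V(r|ξ|)` for all `r > 0`, and let `r⋆ > 0` minimize them over `r > 0` with a
negative minimum. Then `Ṽ(r) = (−1/V_*(r⋆)) V(r⋆ r)` is normalized: `Ṽ → 0`, its lattice sums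
converge, equal `−6` at `r = 1` and are `≥ −6` for every `r > 0` — so the hypotheses "normalized
potential" of Theorems 1.1/1.2 lose no generality among potentials whose `V_*` has a negative
minimum. [cite: Theil2006, §1, remark after Corollary 1.3 (preprint p. 3)] -/
theorem isNormalized_rescalePotential (hV0 : Tendsto V atTop (𝓝 0))
    (hsum : ∀ r : ℝ, 0 < r → Summable fun k : {k : ℤ × ℤ // k ≠ 0} => V (r * ‖triPoint k.1‖))
    (hrs : 0 < rs) (hmin : ∀ r : ℝ, 0 < r → latticeSum V rs ≤ latticeSum V r)
    (hneg : latticeSum V rs < 0) :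
    IsNormalized (rescalePotential V rs) := by
  have hne : latticeSum V rs ≠ 0 := hneg.ne
  have hc : 0 < -6 / latticeSum V rs := div_pos_of_neg_of_neg (by norm_num) hneg
  refine ⟨?_, fun r hr => summable_rescalePotential hsum hrs hr, ?_, fun r hr => ?_⟩
  · -- `Ṽ → 0`
    have h1 : Tendsto (fun r : ℝ => V (rs * r)) atTop (𝓝 0) :=
      hV0.comp (tendsto_id.const_mul_atTop hrs)
    have h2 := h1.const_mul (-6 / latticeSum V rs)
    rw [mul_zero] at h2
    exact h2
  · -- `= -6` at `r = 1`
    rw [latticeSum_rescalePotential, mul_one, div_mul_cancel₀ _ hne]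
  · -- `≥ -6` for `r > 0`
    rw [latticeSum_rescalePotential]
    have h := hmin (rs * r) (mul_pos hrs hr)
    calc (-6 : ℝ) = -6 / latticeSum V rs * latticeSum V rs := by rw [div_mul_cancel₀ _ hne]
      _ ≤ -6 / latticeSum V rs * latticeSum V (rs * r) := mul_le_mul_of_nonneg_left h hc.le

/-! ## "We can simply replace `V(r)` by the rescaled potential": Theorem 1.1 transported

The operative content of the remark: the `N`-particle energies of `V` and of `Ṽ` differ by the
positive factor `−1/V_*(r⋆)` after dilating the configuration by `r⋆`, so minimal energies scale
and Theorem 1.1 for the normalized `Ṽ` (limit `−3 = 3 Ṽ_*(1)`) reads, for `V` itself,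
`lim_N N⁻¹ min E = 3 V_*(r⋆)` (the energy per particle of the optimally dilated lattice `r⋆ A₂`).
[cite: Theil2006, §1, remark after Corollary 1.3 (preprint p. 3)] -/

/-- Energies scale: `E_Ṽ(y) = (−1/V_*(r⋆)) · E_V(r⋆ y)` for every finite configuration `y`
(`r⋆ ≥ 0`). [cite: Theil2006, §1, remark after Corollary 1.3 (preprint p. 3); our lemma] -/
theorem interactionEnergy_rescalePotential (V : ℝ → ℝ) (hrs : 0 ≤ rs) {N : ℕ}
    (y : Fin N → Plane) :
    interactionEnergy (rescalePotential V rs) y =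
      -6 / latticeSum V rs * interactionEnergy V (rs • y) := by
  simp only [interactionEnergy, rescalePotential, Finset.mul_sum, Pi.smul_apply, dist_smul₀,
    Real.norm_of_nonneg hrs]

/-- Minimal energies scale: `min E_Ṽ = (−1/V_*(r⋆)) · min E_V` over all `N`-particle
configurations (`r⋆ > 0`, `V_*(r⋆) ≤ 0`; `y ↦ r⋆ y` is a bijection of the configuration space and
the factor is non-negative). [cite: Theil2006, §1, remark after Corollary 1.3 (preprint p. 3); our lemma] -/
theorem minEnergy_rescalePotential (V : ℝ → ℝ) (hrs : 0 < rs) (hle : latticeSum V rs ≤ 0)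
    (N : ℕ) :
    minEnergy (rescalePotential V rs) N = -6 / latticeSum V rs * minEnergy V N := by
  have hc : 0 ≤ -6 / latticeSum V rs := div_nonneg_of_nonpos (by norm_num) hle
  have hsurj : Function.Surjective fun y : Fin N → Plane => rs • y := fun z =>
    ⟨rs⁻¹ • z, by simp [smul_smul, mul_inv_cancel₀ hrs.ne']⟩
  unfold minEnergy
  simp_rw [interactionEnergy_rescalePotential V hrs.le]
  rw [← Real.mul_iInf_of_nonneg hc, hsurj.iInf_comp fun z => interactionEnergy V z]

/-- Limits of the energy per particle transfer from `Ṽ` to `V` with the factor `−V_*(r⋆)`: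
`N⁻¹ min E_Ṽ → a` implies `N⁻¹ min E_V → −V_*(r⋆) · a` (`r⋆ > 0`, `V_*(r⋆) < 0`).
[cite: Theil2006, §1, remark after Corollary 1.3 (preprint p. 3); our lemma] -/
theorem tendsto_minEnergy_div_of_rescalePotential (V : ℝ → ℝ) (hrs : 0 < rs)
    (hneg : latticeSum V rs < 0) {a : ℝ}
    (h : Tendsto (fun N : ℕ => minEnergy (rescalePotential V rs) N / N) atTop (𝓝 a)) :
    Tendsto (fun N : ℕ => minEnergy V N / N) atTop (𝓝 (-renormalizedPotential V rs * a)) := by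
  have hne : latticeSum V rs ≠ 0 := hneg.ne
  have key : (fun N : ℕ => minEnergy V N / N) =
      fun N : ℕ => -renormalizedPotential V rs * (minEnergy (rescalePotential V rs) N / N) := by
    funext N
    rw [minEnergy_rescalePotential V hrs hneg.le, renormalizedPotential]
    field_simp
  rw [key]
  exact h.const_mul _

end Theil2006

open Theil2006 in
/-- **Theorem 1.1 for a potential that is not normalized** ("we can simply replace `V(r)` by the
rescaled potential", p. 3): granted Theorem 1.1 (`Theil2006_groundStateEnergy`), if `r⋆ > 0` with
`V_*(r⋆) < 0` is such that the rescaled potential `Ṽ = (−1/V_*(r⋆)) V(r⋆ ·)` satisfies the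
hypotheses (1)–(5) for a small `α`, then `lim_{N → ∞} N⁻¹ min_y E(y) = 3 V_*(r⋆)` — the energy per
particle of the dilated lattice `r⋆ A₂` (`= −3` in the normalized case `r⋆ = 1`, `V_*(1) = −1`).
[cite: Theil2006, §1 Theorem 1.1 and the remark after Corollary 1.3 (preprint pp. 2–3)] -/
theorem Theil2006_groundStateEnergy.of_rescalePotential (h : Theil2006_groundStateEnergy) :
    ∃ α₀ : ℝ, 0 < α₀ ∧ α₀ < 1 / 3 ∧ ∀ α : ℝ, 0 < α → α < α₀ → ∀ (V : ℝ → ℝ) (rs : ℝ), 0 < rs →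
      latticeSum V rs < 0 → IsAdmissible α (rescalePotential V rs) →
        Tendsto (fun N : ℕ => minEnergy V N / N) atTop (𝓝 (3 * renormalizedPotential V rs)) := by
  obtain ⟨α₀, hα₀, hα₀', hmain⟩ := h
  refine ⟨α₀, hα₀, hα₀', fun α hα hαα₀ V rs hrs hneg hadm => ?_⟩
  have hlim := tendsto_minEnergy_div_of_rescalePotential V hrs hneg (hmain α hα hαα₀ _ hadm)
  convert hlim using 2
  ring

end Literature.MathematicalPhysics.StatisticalMechanics

end
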